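/-
Copyright: cell pub-balaban-gaps (YM BLITZ Y1, track G1), seat g1-p2 GEN 9 (unit `pub-balaban-gaps-g1-p2`).  Row (D4) NODE O,
JUNCTION J-3 (multi-level) — THE LOOP CLOSED AT MODEL LEVEL: lit-balaban's TYPED body of (3.35) (`B9Eq335RegularityClasses.Reg335Cube`, on
the torus with matrices in the `ℓ^∞`-operator norm, one scale `ξ`) ⟹ (96's dictionary) the gauge hypotheses ⟹ (92) the Green function of
the covariant multi-level operator AT THE BACKGROUND `U` ITSELF is a block walk expansion.  HONEST FRAMING: print's geometry (Ω′₀ ⊂ □, a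
cube of T_{L^{−j}}; here □ = T) and print's operator norm on `ℂ^N` (here the `ℓ^∞`-operator norm, the (ν) dictionary) are MODEL choices;
`U` is a fixed (configuration-independent) background — the complex (3.37) neighbourhood `U′U` is 95's shape; (D4) NOT discharged (instance
0∕1); NOT BetaPertH, NOT continuum, NOT Clay.
-/
import Summits.QuantumFields.BalabanUV.Gaps.D4WalkBlockCovariantGaugeExpMultiLevel
import Summits.QuantumFields.BalabanUV.Gaps.D4WalkBlockReg335Dictionary

/-!
# `Gaps.D4WalkBlockCovariantGreenReg335MultiLevel` — `Reg335Cube` (typed (3.35)) on the torus ⟹ the Green-function block walk expansion at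
# the background (cell pub-balaban-gaps, seat g1-p2 gen 9)

HONEST DEPENDENCY (cell pub-balaban, verbatim): continuum YM on T⁴ ⇐ BetaPertH ∧ nine spine estimates (0/9 proved);
BetaPertH ⇐ (D1) ∧ (D4) ∧ CAP+tail.

**`blockWalkExpansion_covariantGreen_reg335_multiLevelTorus`**: for a background `U₀ : bonds → (Matrix (Fin N) (Fin N) ℂ)ˣ` on [4]'s nested
family with `Reg335Cube sh U₀ η univ ξ C` (lit-balaban: «∃ u, A: U₀^u = e^{iηA}, |A| < Cξ⁻¹, |∇^ηA| < Cξ⁻²», `‖u‖, ‖u⁻¹‖ ≤ 1`) at a scale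
with `|η|Cξ⁻¹ ≤ a₀L^{−k}`, `|η|²Cξ⁻² ≤ a₁L^{−2k}`, connected contours from block base points, and 92's margin at `(a₀, a₁)`: the Green function
`(Δ_W(U₀) + L^{2k}covAvgOp(U₀,Γ))⁻¹` is a block walk expansion with Cor. 3.5's walks (92 ∘ 96; `r = r′ = 1`).
WHAT IT IS NOT.  Small plaquettes ⟹ (3.35) ([5]∕[B10], row (D2)); the (3.37) neighbourhood (95); print's geometry; (D4) instance 0∕1.

References: T. Bałaban, Comm. Math. Phys. **99** (1985) 389–434 [B9], (3.35) p. 396, Cor. 3.5 p. 407, Cor. 3.6 p. 408; Comm. Math. Phys.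
**96** (1984) [4], (2.13)–(2.14) p. 225; Comm. Math. Phys. **116** (1988) [II], (1.11) p. 5.
-/

noncomputable section

namespace Summit.QuantumFields.BalabanUV.Gaps.D4WalkBlockCovariantGreenReg335MultiLevel

open Metric NormedSpace
open scoped Matrix
open Literature.MathematicalPhysics.QuantumFieldTheory.Balaban1983to89
open Literature.MathematicalPhysics.QuantumFieldTheory.Balaban1983to89.B4Reflection242 (boxDom blk)
open Literature.MathematicalPhysics.QuantumFieldTheory.Balaban1983to89.B9SectDWalk (DomBy)
open Literature.MathematicalPhysics.QuantumFieldTheory.Balaban1983to89.B9Thm34Ext (toB6)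
open Literature.MathematicalPhysics.QuantumFieldTheory.Balaban1983to89.B9Thm37GlueTorus (torusGeom tdist1)
open Literature.MathematicalPhysics.QuantumFieldTheory.Balaban1983to89.TreeLengthTorus (TPt)
open Literature.MathematicalPhysics.QuantumFieldTheory.Balaban1983to89.B5TorusCover (UT)
open Literature.MathematicalPhysics.QuantumFieldTheory.Balaban1983to89.B11SectG (RowSum)
open Literature.MathematicalPhysics.QuantumFieldTheory.Balaban1983to89.B6MultiLevelBoxOperator (N0)
open Literature.MathematicalPhysics.QuantumFieldTheory.Balaban1983to89.B6MultiLevelTorusOperator (TDomains gmlT tshift unitVec)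
open Literature.MathematicalPhysics.QuantumFieldTheory.Balaban1983to89.B6Ineq243TwoLevelBox (aNext)
open Summit.QuantumFields.BalabanUV.Gaps.D4WalkBlock (blockNorm BlockWalkExpansion)
open Summit.QuantumFields.BalabanUV.Gaps.D4WalkBlockMultiLevelGeometry (cubeML)
open Summit.QuantumFields.BalabanUV.Gaps.D4WalkBlockTransportAlgebra (rowSumNorm)
open Summit.QuantumFields.BalabanUV.Gaps.D4WalkBlockShiftStep (covLap)
open Summit.QuantumFields.BalabanUV.Gaps.D4WalkBlockShiftWeighted (covDopW covBW covAlphaW)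
open Summit.QuantumFields.BalabanUV.Gaps.D4WalkBlockWeightedLettersMultiLevel (levW)
open Summit.QuantumFields.BalabanUV.Gaps.D4WalkBlockCovariantAveragingMultiLevel (covAvgOp)
open Summit.QuantumFields.BalabanUV.Gaps.D4WalkBlockCovariantContourMultiLevel (contourT contourTi)
open Summit.QuantumFields.BalabanUV.Gaps.D4WalkBlockCovariantBondFieldMultiLevel (inv_pow_lev_tshift_symm_le)
open Summit.QuantumFields.BalabanUV.Gaps.D4WalkBlockCovariantExpFieldMultiLevel (expWindow_bond expWindow_deriv)
open Summit.QuantumFields.BalabanUV.Gaps.D4WalkBlockExpHolo (differentiableOn_exp_entry_family differentiableOn_exp_neg_entry_family)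
open Summit.QuantumFields.BalabanUV.Gaps.D4WalkBlockContourPath (IsPath)
open Summit.QuantumFields.BalabanUV.Gaps.D4WalkBlockCovariantGaugeExpMultiLevel (blockWalkExpansion_covariantGreen_gaugeExp_multiLevelTorus)
open Summit.QuantumFields.BalabanUV.Gaps.D4WalkBlockReg335Dictionary (gaugeHyps_of_reg335Cube_torus weighted_of_scale)
open Literature.MathematicalPhysics.QuantumFieldTheory.Balaban1983to89.B9Eq335RegularityClasses (Reg335Cube)

variable {d : ℕ}

section Green

open scoped Matrix.Norms.Operator

variable {dd N' : ℕ} {E : Type*} [NormedAddCommGroup E] [NormedSpace ℂ E]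

/-- **TYPED (3.35) ON THE TORUS ⟹ THE GREEN-FUNCTION BLOCK WALK EXPANSION AT THE BACKGROUND** (96's dictionary fed into 92).
[cite: Balaban1985BackgroundPropagators, (3.35) p.396, Cor. 3.5 p.407, Cor. 3.6 p.408; Balaban1984PropagatorsII, (2.13)–(2.14) p.225; Balaban1988RG2Cluster, (1.11) p.5] -/
theorem blockWalkExpansion_covariantGreen_reg335_multiLevelTorus (d ℓ : ℕ) (hℓ : 1 ≤ ℓ) (aminus aplus a2minus a2plus : ℝ)
    (ha : 0 < aminus) (ha2 : 0 < a2minus) :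
    ∃ δ₁ C M₀ : ℝ, ∃ N₀ : ℕ, 0 < δ₁ ∧ 0 < C ∧ 0 < M₀ ∧ 0 < N₀ ∧
      ∀ (k Mh R : ℕ), 3 ≤ Mh → M₀ ≤ ((ℓ : ℝ) + 1) * Mh → 2 * (ℓ + 1) ≤ R → N₀ + 1 ≤ R * ((ℓ + 1) * Mh) →
      ∀ (P : Fin (d + 1) → ℕ) (hP : ∀ μ, 1 ≤ P μ) (hP4 : ∀ μ, 4 ≤ P μ) (D : TDomains d ℓ Mh k P R) (a c : ℕ → ℝ),
        (∀ i, 1 ≤ i → aminus ≤ a i ∧ a i ≤ aplus) → (∀ i, 1 ≤ i → a2minus ≤ c i ∧ c i ≤ a2plus) →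
        (∀ i, 1 ≤ i → a (i + 1) = aNext ℓ (a i) (c i)) →
      ∀ (Kc : Fin (d + 1) → ℕ) [∀ i, NeZero (Kc i)], (∀ i, N0 ℓ Mh k P i = (ℓ + 1) ^ k * Kc i) →
      ∀ (N : ℕ) (c₀ : B13.Consts) (Xs : Finset (UT Kc)) (Rb : ℝ)
        (U₀ : Fin (d + 1) → ↥(boxDom (N0 ℓ Mh k P)) → (Matrix (Fin N) (Fin N) ℂ)ˣ)
        (Γ : ↥(boxDom (N0 ℓ Mh k P)) → List (↥(boxDom (N0 ℓ Mh k P)) × Fin (d + 1)))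
        (β : ↥(boxDom (N0 ℓ Mh k P)) → ↥(boxDom (N0 ℓ Mh k P)))
        (η ξ Cr a₀ a₁ ε μ cμ : ℝ), η ≠ 0 →
      Reg335Cube (fun ν => tshift (N0 ℓ Mh k P) (unitVec ν)) U₀ η (Set.univ : Set ↥(boxDom (N0 ℓ Mh k P))) ξ Cr →
      |η| * Cr * ξ⁻¹ ≤ a₀ * ((((ℓ : ℝ) + 1) ^ k))⁻¹ → |η| ^ 2 * Cr * (ξ ^ 2)⁻¹ ≤ a₁ * ((((ℓ : ℝ) + 1) ^ k))⁻¹ ^ 2 →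
      (∀ x, IsPath (fun ν => tshift (N0 ℓ Mh k P) (unitVec ν)) (Γ x) (β x) x) →
      (∀ x x' : ↥(boxDom (N0 ℓ Mh k P)), blk ((ℓ + 1) ^ D.lev x.1) x'.1 = blk ((ℓ + 1) ^ D.lev x.1) x.1 → β x' = β x) →
      0 ≤ a₀ → 0 ≤ a₁ →
      (∀ x, (Γ x).length ≤ (d + 1) * (ℓ + 1) ^ D.lev x.1) →
      (∀ x, ∀ b ∈ Γ x, blk ((ℓ + 1) ^ D.lev x.1) b.1.1 = blk ((ℓ + 1) ^ D.lev x.1) x.1) →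
      0 ≤ μ → 2 * μ ≤ ε → 2 * μ ≤ δ₁ - ε - μ → 0 ≤ cμ →
      RowSum (toB6 (torusGeom Kc 0 0 0) 0 True) μ cμ →
      cμ * (cμ * 1 * (1 * ((0 + ∑ j : Unit ⊕ (Fin (d + 1) ⊕ Fin (d + 1)),
        covAlphaW (((ℓ : ℝ) + 1) * (a₀ * Real.exp a₀)) (((d : ℝ) + 1) * ((a₁ * Real.exp (((ℓ : ℝ) + 1) * a₀)) + (((ℓ : ℝ) + 1) * (a₀ * Real.exp a₀)) ^ 2) +
          aplus * (Real.exp (2 * ((d : ℝ) + 1) * (a₀ * Real.exp a₀)) - 1)) j * covBW δ₁ ((ℓ : ℝ) + 1) j) * C)) * cμ) * cμ < 1 →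
      ∃ (W : Type) (T : W → (TPt dd N' → ℂ) → E → Matrix (↥(boxDom (N0 ℓ Mh k P)) × Fin N) (↥(boxDom (N0 ℓ Mh k P)) × Fin N) ℂ)
        (SX' : Set W) (A' : W → ℝ) (D' : W → UT Kc → UT Kc → ℝ),
        BlockWalkExpansion c₀ (fun q : ↥(boxDom (N0 ℓ Mh k P)) × Fin N => cubeML ℓ k Kc q.1.1)
          (fun q : ↥(boxDom (N0 ℓ Mh k P)) × Fin N => cubeML ℓ k Kc q.1.1)
          (fun (_ : TPt dd N' → ℂ) u =>
            (covLap ↥(boxDom (N0 ℓ Mh k P)) (Fin N) (fun ν => tshift (N0 ℓ Mh k P) (unitVec ν)) ((((ℓ : ℝ) + 1) ^ k)⁻¹)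
                (fun ν _ x => (U₀ ν x : Matrix (Fin N) (Fin N) ℂ) - 1)
                (fun ν _ x => (((U₀ ν ((tshift (N0 ℓ Mh k P) (unitVec ν)).symm x))⁻¹ : (Matrix (Fin N) (Fin N) ℂ)ˣ) : Matrix (Fin N) (Fin N) ℂ) - 1) u +
              (((ℓ : ℂ) + 1) ^ (2 * k) : ℂ) • covAvgOp D a (contourT Γ fun _ b => (U₀ b.2 b.1 : Matrix (Fin N) (Fin N) ℂ))
                (contourTi Γ fun _ b => (((U₀ b.2 b.1)⁻¹ : (Matrix (Fin N) (Fin N) ℂ)ˣ) : Matrix (Fin N) (Fin N) ℂ)) u)⁻¹)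
          Xs Rb (ε - 2 * μ) (δ₁ - ε - μ - 2 * μ)
          (1 * 1 * (cμ * C * (1 * (1 - cμ * (cμ * 1 * (1 * ((0 + ∑ j : Unit ⊕ (Fin (d + 1) ⊕ Fin (d + 1)),
            covAlphaW (((ℓ : ℝ) + 1) * (a₀ * Real.exp a₀)) (((d : ℝ) + 1) * ((a₁ * Real.exp (((ℓ : ℝ) + 1) * a₀)) + (((ℓ : ℝ) + 1) * (a₀ * Real.exp a₀)) ^ 2) +
              aplus * (Real.exp (2 * ((d : ℝ) + 1) * (a₀ * Real.exp a₀)) - 1)) j * covBW δ₁ ((ℓ : ℝ) + 1) j) * C)) * cμ) * cμ)⁻¹) * cμ))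
          T SX' A' D' (δ₁ - 2 * μ) ∧
        ∀ ω, DomBy (toB6 (torusGeom Kc 0 0 0) 0 True) (D' ω) := by
  obtain ⟨δ₁, C, M₀, N₀, hδ₁, hC, hM₀, hN₀, hmain⟩ :=
    blockWalkExpansion_covariantGreen_gaugeExp_multiLevelTorus (dd := dd) (N' := N') (E := E) d ℓ hℓ aminus aplus a2minus a2plus ha ha2
  refine ⟨δ₁, C, M₀, N₀, hδ₁, hC, hM₀, hN₀, ?_⟩
  intro k Mh R hMh hM hR hRM P hP hP4 D a c haw hcw hac Kc _ hKc N c₀ Xs Rb U₀ Γ β η ξ Cr a₀ a₁ ε μ cμ hη hreg hsc0 hsc1 hpath hβ ha₀ ha₁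
    hlen hblkΓ hμ hμε hμκ hcμ hrow hq
  obtain ⟨g, gi, X, hg, hgi, hrgi, hrg, hrel, hreli, hX0, hX1⟩ := gaugeHyps_of_reg335Cube_torus U₀ hη hreg
  obtain ⟨hW0, hW1⟩ := weighted_of_scale D (X := X) ha₀ ha₁ hX0 hX1 hsc0 hsc1
  exact hmain k Mh R hMh hM hR hRM P hP hP4 D a c haw hcw hac Kc hKc N c₀ Xs Rb
    (fun ν _ y => (U₀ ν y : Matrix (Fin N) (Fin N) ℂ)) (fun ν _ y => (((U₀ ν y)⁻¹ : (Matrix (Fin N) (Fin N) ℂ)ˣ) : Matrix (Fin N) (Fin N) ℂ))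
    (fun ν _ y => X ν y) Γ β g gi 1 1 a₀ a₁ ε μ cμ hg hgi zero_le_one zero_le_one hrgi hrg hpath hβ (fun ν u y => hrel ν y)
    (fun ν u y => hreli ν y) (fun ν y a' b => differentiableOn_const _) ha₀ ha₁ (fun ν u _ y a' => hW0 ν y a')
    (fun ν u _ x a' => hW1 ν x a') hlen hblkΓ hμ hμε hμκ hcμ hrow hq

end Green

end Summit.QuantumFields.BalabanUV.Gaps.D4WalkBlockCovariantGreenReg335MultiLevel

end
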